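import Summits.QuantumFields.BalabanUV.Beta.EriceRemainderEnclosureHistoryAutonomyComparisonTowerChainSix

/-!
# EriceRemainderEnclosureHistoryAutonomyComparisonAgeCompositionStaticChainWindowBounds — (E72d) TWO-SIDED CLOSED FORMS FOR (E65a)'S WINDOW READS,
# `2√k(√(k+j+1) − √(k+1)) ≤ S_{k,j} = Σ_{l<j} √(k∕(k+l+1)) ≤ 2√k(√(k+j) − √k)` (sum vs. integral of the non-increasing profile `√(k∕(k+t))`), hence
# `s_j = S_{j,j}∕j ≤ 2(√2 − 1)`: the DISCRETISATION LEMMA that turns the budget polytope of route (N) into explicit algebraic constraints uniformly in the scale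

Cell `pub-balaban`, β-function sub-cell, BINDER row D4 «RemainderConst leaves for Bałaban's split» (`HOME/BINDER-OWNERS.md`; owner lineage `b2b-balaban-beta-an4`;
this file by co-owner #2 lineage `b2b-balaban-beta-d4-p2`, generation 63), β-FLOW TEAM duty (1), FREEZE (0) honoured (def-free; imports (E66)'s `…ComparisonTowerChainSix`
for the LOWER telescoped bound `readWindow_ge_telescope`, used BY NAME; the window read is written exactly as in (E65a) `…ComparisonLoadBudgetWindow`
(`Σ_{l<j} √(k∕(k+l+1))`, there over natural `k`; here for every real `k > 0`); nothing restated).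

HONEST FRAMING (page 1, verbatim and binding).  *"Discharging BetaPertH makes Bałaban's UV stability UNCONDITIONAL — a real constructive-QFT result; it is
NOT the continuum limit and NOT the Clay problem."*  THIS FILE DISCHARGES NOTHING OF THE KIND.  Elementary calculus (sum–integral comparison for a monotone
function, `d∕dt 2√k√(k+t) = √(k∕(k+t))`); the form, signs, ages and moments of Bałaban's (1.22) limit functional are NOT PRINTED ([I] p. 298; GAPS G-t4-U2-1∕-2)
and NOT asserted.  Row D4 class UNCHANGED (critical-path width 0; instance 0∕1; D4 DISCHARGE NO DATE).  HONEST DEPENDENCY: continuum YM on T⁴ ⇐ BetaPertH ∧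
nine spine estimates (0/9 proved); BetaPertH ⇐ (D1) ∧ (D4) ∧ CAP+tail; G-an2-4 gates asym, D1 and NE2/3/4.

THE POINT (census sense (α); route (N), README `g63/e72` §§4–6).  The budget-form static closure is a statement about (E65a)'s polytope
`{x ≥ 0 : Σ_{k≤j} x_k S_{k,j}∕j + Σ_{k>j} x_k S_{k,j}∕k ≤ ½ ∀ j}`; every reduction of gen 63 (normal form, far recursion, near-window lemmas) is eventually a
statement about the CONTINUUM profile of the charges `c_j(k) = S_{k,j}∕max(k,j)` (`≈ 2∕(1+√(1+j∕k))` below the scale, `≈ (j∕k)`-like above), uniformly in the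
scale.  This file supplies the uniform two-sided comparison: §1 the profile `t ↦ √(k∕(k+t))` is non-increasing on `[0,∞)` and has the primitive `2√k·√(k+t)`
(`antitoneOn_profile`, `hasDerivAt_primitive`, `integral_profile` — both integral directions are thereby available); §2 **`readWindow_le`** (`S_{k,j} ≤
2√k(√(k+j) − √k)`, Mathlib's `AntitoneOn.sum_le_integral`); the matching LOWER bound `2√k(√(k+j+1) − √(k+1)) ≤ S_{k,j}` is ALREADY in the tree as (E66)
`…TowerChainSix.readWindow_ge_telescope` (telescoping, no integrals) and is used by name — together: the discrete read is within ONE summand of the continuum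
read `2k(√(1+j∕k) − 1)` at every scale; §3 ratio forms `readWindow_le_ratio`, `le_readWindow_ratio` and **`readWindow_self_le`: `S_{j,j} ≤ 2(√2−1)·j`**, i.e. the
young's own-scale weight `s_j ∈ [1∕√2, 2(√2−1)] = [0.707, 0.828]` for every `j ≥ 1` (lower end: (E65a) termwise; upper end: here) — the two constants behind the
lone caps `x_j ≤ j∕(2S_{j,j}) ∈ [0.604, 0.707]` quoted throughout the READMEs.  NOT CLAIMED: anything about the flow or the chain; anything printed.
-/
noncomputable section
open Finset Set MeasureTheory intervalIntegral

namespace Summit.QuantumFields.BalabanUV.Beta.EriceRemainderEnclosureHistoryAutonomyComparisonAgeCompositionStaticChainWindowBounds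

open Summit.QuantumFields.BalabanUV.Beta.EriceRemainderEnclosureHistoryAutonomyComparisonTowerChainSix (readWindow_ge_telescope)

/-! ## §1 The profile and its primitive -/

/-- The window-read profile `t ↦ √(k∕(k+t))` is non-increasing on `[0, ∞)` for `k > 0`. [folklore] -/
theorem antitoneOn_profile {k : ℝ} (hk : 0 < k) : AntitoneOn (fun t : ℝ => Real.sqrt (k / (k + t))) (Ici 0) := by
  intro a ha b hb hab
  apply Real.sqrt_le_sqrt
  have ha' : 0 ≤ a := ha
  exact div_le_div_of_nonneg_left hk.le (by linarith) (by linarith)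

/-- Antiderivative: `d∕dt [2√k·√(k+t)] = √(k∕(k+t))` for `k > 0`, `t ≥ 0`. [folklore] -/
theorem hasDerivAt_primitive {k t : ℝ} (hk : 0 < k) (ht : 0 ≤ t) :
    HasDerivAt (fun s : ℝ => 2 * Real.sqrt k * Real.sqrt (k + s)) (Real.sqrt (k / (k + t))) t := by
  have hkt : k + t ≠ 0 := by linarith
  have h1 : HasDerivAt (fun s : ℝ => k + s) 1 t := (hasDerivAt_id t).const_add k
  have h2 := (h1.sqrt hkt).const_mul (2 * Real.sqrt k)
  refine h2.congr_deriv ?_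
  rw [Real.sqrt_div hk.le]
  have hpos : 0 < Real.sqrt (k + t) := Real.sqrt_pos.mpr (by linarith)
  field_simp

/-- The integral of the profile over `[a, b]` with `0 ≤ a ≤ b`. [folklore] -/
theorem integral_profile {k a b : ℝ} (hk : 0 < k) (ha : 0 ≤ a) (hab : a ≤ b) :
    ∫ t in a..b, Real.sqrt (k / (k + t)) = 2 * Real.sqrt k * Real.sqrt (k + b) - 2 * Real.sqrt k * Real.sqrt (k + a) := by
  apply integral_eq_sub_of_hasDerivAt
  · intro x hx
    rw [uIcc_of_le hab, Set.mem_Icc] at hx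
    exact hasDerivAt_primitive hk (ha.trans hx.1)
  · apply AntitoneOn.intervalIntegrable
    rw [uIcc_of_le hab]
    exact (antitoneOn_profile hk).mono (Icc_subset_Ici_iff hab |>.mpr ha)

/-! ## §2 Two-sided closed forms -/

/-- **UPPER CLOSED FORM OF THE WINDOW READ**: `S_{k,j} = Σ_{l<j} √(k∕(k+l+1)) ≤ 2√k·(√(k+j) − √k)` for `k > 0`. [folklore] -/
theorem readWindow_le {k : ℝ} (hk : 0 < k) (j : ℕ) :
    ∑ l ∈ range j, Real.sqrt (k / (k + l + 1)) ≤ 2 * Real.sqrt k * (Real.sqrt (k + j) - Real.sqrt k) := by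
  have hmono : AntitoneOn (fun t : ℝ => Real.sqrt (k / (k + t))) (Icc (0 : ℝ) (0 + j)) :=
    (antitoneOn_profile hk).mono fun x hx => (Set.mem_Icc.mp hx).1
  have h := AntitoneOn.sum_le_integral hmono
  have hj : (0 : ℝ) ≤ 0 + j := by positivity
  have hint : ∫ t in (0 : ℝ)..0 + j, Real.sqrt (k / (k + t)) = 2 * Real.sqrt k * Real.sqrt (k + j) - 2 * Real.sqrt k * Real.sqrt (k + 0) := by
    rw [integral_profile hk le_rfl hj, zero_add]
  rw [hint, add_zero] at h
  have hsum : ∑ l ∈ range j, Real.sqrt (k / (k + l + 1)) = ∑ i ∈ range j, Real.sqrt (k / (k + ((0 : ℝ) + ↑(i + 1)))) :=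
    sum_congr rfl fun i _ => by push_cast; ring_nf
  rw [hsum]
  linarith

/-! ## §3 Ratio forms and the own-scale weight -/

/-- Ratio form of the upper bound: `S_{k,j} ≤ 2k·(√(1 + j∕k) − 1)` (`= 2√k(√(k+j) − √k)`), the continuum window read. [folklore] -/
theorem readWindow_le_ratio {k : ℝ} (hk : 0 < k) (j : ℕ) :
    ∑ l ∈ range j, Real.sqrt (k / (k + l + 1)) ≤ 2 * k * (Real.sqrt (1 + j / k) - 1) := by
  have h := readWindow_le hk j
  have h1 : Real.sqrt (k + j) = Real.sqrt k * Real.sqrt (1 + j / k) := by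
    rw [← Real.sqrt_mul hk.le]; congr 1; field_simp
  have h2 : Real.sqrt k * Real.sqrt k = k := Real.mul_self_sqrt hk.le
  rw [h1] at h
  nlinarith [h2, Real.sqrt_nonneg k, Real.sqrt_nonneg (1 + j / k)]

/-- **THE OWN-SCALE WEIGHT IS BELOW ITS CONTINUUM VALUE**: `S_{j,j} ≤ 2(√2 − 1)·j` for every `j ≥ 1`, i.e. `s_j = S_{j,j}∕j ≤ 2(√2 − 1) = 0.828…` (and
`s_j ≥ 1∕√2` termwise, (E65a)).  [folklore] -/
theorem readWindow_self_le {j : ℕ} (hj : 1 ≤ j) :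
    ∑ l ∈ range j, Real.sqrt ((j : ℝ) / ((j : ℝ) + l + 1)) ≤ 2 * (Real.sqrt 2 - 1) * j := by
  have hj' : (0 : ℝ) < j := by exact_mod_cast hj
  have h := readWindow_le_ratio hj' j
  have h1 : (1 : ℝ) + (j : ℝ) / (j : ℝ) = 2 := by rw [div_self hj'.ne']; norm_num
  rw [h1] at h
  linarith

/-- Ratio form of the lower bound: `S_{k,j} ≥ 2k·(√(1 + (j+1)∕k) − √(1 + 1∕k))` (`= 2√k(√(k+j+1) − √(k+1))`): the discrete window read is within one
summand of its continuum value, uniformly in the scale. [folklore] -/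
theorem le_readWindow_ratio {k : ℝ} (hk : 0 < k) (j : ℕ) :
    2 * k * (Real.sqrt (1 + (j + 1) / k) - Real.sqrt (1 + 1 / k)) ≤ ∑ l ∈ range j, Real.sqrt (k / (k + l + 1)) := by
  have h := readWindow_ge_telescope hk j
  have h1 : Real.sqrt (k + j + 1) = Real.sqrt k * Real.sqrt (1 + (j + 1) / k) := by
    rw [← Real.sqrt_mul hk.le]; congr 1; field_simp; ring
  have h3 : Real.sqrt (k + 1) = Real.sqrt k * Real.sqrt (1 + 1 / k) := by
    rw [← Real.sqrt_mul hk.le]; congr 1; field_simp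
  have h2 : Real.sqrt k * Real.sqrt k = k := Real.mul_self_sqrt hk.le
  rw [h1, h3] at h
  nlinarith [h2, Real.sqrt_nonneg k, Real.sqrt_nonneg (1 + (j + 1) / k), Real.sqrt_nonneg (1 + 1 / k)]

end Summit.QuantumFields.BalabanUV.Beta.EriceRemainderEnclosureHistoryAutonomyComparisonAgeCompositionStaticChainWindowBounds

end
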